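import Summits.NavierStokesRegularity.NavierStokesRegularity.Theorems.GaldiLiouvilleGateParabolicGaldiLiouvilleTightnessSharp
import Summits.NavierStokesRegularity.NavierStokesRegularity.Theorems.GaldiLiouvilleGateParabolicGaldiLiouvilleStubOseenMildOfL6
import Summits.NavierStokesRegularity.NavierStokesRegularity.Theorems.GaldiLiouvilleGateParabolicGaldiLiouvilleStubLpsOfSobolev
import Summits.NavierStokesRegularity.NavierStokesRegularity.Theorems.PlaneEnergyCeilingPlanarEnergyLiouvilleL3Corner
import Literature.Analysis.FluidPDE.AncientL3BackwardLiouvilleHolds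
import HarnessLib

/-!
# Crux `ParabolicGaldiLiouville` (stmt-NavierStokesRegularity-0893), line `birth`, reshaping 3
# (two-gate, lead c2): the BACKWARD-`L³` GATE — corners closed unconditionally, and tightness

Support file (`--supports stmt-NavierStokesRegularity-0893`). The two-gate skeleton
(`Cruxes/ParabolicGaldiLiouville/Lines/birth.lean`, reshaping 3) weakens the open stub of the line
to "every flow of the X2 class passes the `(6,4)` gate OR the backward-`L³` gate". This file
records what the SECOND gate buys, with no open hypothesis left:

* `L3Corner.eLpNorm_six_le`, `L3Corner.oseenMild` — the X2 class (bounded ancient mild solution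
  in duality form, smooth on `(−∞,0) × ℝ³`, enstrophy `≤ C`, `L⁶` slices) has UNIFORMLY `L⁶`
  slices (`‖v(s)‖₆ ≤ K C^{1/2}`, landed stub 2a) and therefore solves the Oseen integral
  equation `v(t) = e^{(t−s)Δ}v(s) − B¹ₛ(v,v)(t)` for all `s < t < 0` (landed stub
  `stub_oseenMildOfL6`, p164272): the crux may equivalently be read over KNSS's
  integral-equation class (no parasitic drift survives the `L⁶` hypothesis).
* `parabolicGaldiLiouville_L3Corner` — **X2 holds for every flow of the class whose `L³` norms
  are bounded along ONE sequence of times `τ_k → −∞`** (Albritton–Barker 2019, Thm 1.2, proved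
  in the tree: `AlbrittonBarker2019_liouville_L3_backward_holds`).
* `parabolicGaldiLiouville_energyCorner` — hence for every flow with bounded kinetic energy
  along one backward sequence (`‖w‖₃³ ≤ ‖w‖_∞ ‖w‖₂²`, reused from the `PlaneEnergyCeiling`
  corner file): the FINITE-ENERGY corner of X2.
* `parabolicGaldiLiouville_periodic_L3` — and for every backward-TIME-PERIODIC flow of the class
  with a single slice in `L³` (the rung "time-periodic finite-enstrophy flows" of the route's
  layer-2 plan, in its `L³` corner).
* `galdiLiouville_of_twoGate` — TIGHTNESS: the weakened open stub `stub_twoGate` still contains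
  Galdi's Liouville problem (crux 0895 `GaldiLiouville`): for the steady inhabitant `fun _ => W`
  of the class built from a D-solution, gate 1 forces `∫|∇W|_F² = 0` and gate 2 puts `W ∈ L³`,
  where the corner above applies; either way `W = 0`.

So after reshaping 3 the crux is, in Lean: `(L) ⇒ X2 ⇔ [two-gate property in class] ⇒ 0895`,
with X2 PROVED on: KNSS symmetric classes (p150486), enstrophy decay faster than self-similar
(p153466), backward-`L³`-bounded flows, finite-energy flows, periodic flows with an `L³` slice
(this file).

References: D. Albritton, T. Barker, J. Math. Fluid Mech. 21 (2019) = arXiv:1811.00502, Thm 1.2;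
G. Koch, N. Nadirashvili, G. Seregin, V. Šverák, Acta Math. 203 (2009) = arXiv:0709.3599, §1,
Lemma 3.1, §4; G. P. Galdi, *Steady-State NS* (2011), Rem. X.9.4, Thm X.9.5.
-/

noncomputable section

-- `Sub = summit`: the duplicated namespace component `NavierStokesRegularity` is deliberate.
set_option linter.dupNamespace false

namespace Summit.NavierStokesRegularity.NavierStokesRegularity.Theorems.ParabolicGaldiLiouville.Birth

open MeasureTheory Filter Topology Set Function Metric
open scoped ENNReal NNReal
open Literature.Analysis Literature.Analysis.FluidPDE

namespace L3Corner

/-- **Uniform `L⁶` bound in the X2 class.** A field smooth on `(−∞,0) × ℝ³` with `L⁶` slices and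
enstrophy bounded by `C` has `‖v(s)‖_{L⁶} ≤ K C^{1/2}` for every `s < 0`, `K` the constant of the
landed slice-wise Sobolev inequality `stub_sobolevSixFrobenius` (Ḣ¹ ∩ L⁶ ⊂ L⁶ for `C¹` fields). -/
theorem eLpNorm_six_le {v : ℝ → EuclideanSpace ℝ (Fin 3) → EuclideanSpace ℝ (Fin 3)}
    (hsm : ContDiffOn ℝ (⊤ : ℕ∞) (uncurry v) (Iio 0 ×ˢ univ))
    (hens : ∃ C : NNReal, ∀ s < 0, ∫⁻ y, ENNReal.ofReal (frobeniusNormSq (fderiv ℝ (v s) y)) ≤ C)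
    (hL6 : ∀ s < 0, MemLp (v s) 6 volume) :
    ∃ K' : NNReal, ∀ s < 0, eLpNorm (v s) 6 volume ≤ K' := by
  obtain ⟨K, hK⟩ := stub_sobolevSixFrobenius
  obtain ⟨C, hC⟩ := hens
  have hfin : (K : ℝ≥0∞) * (C : ℝ≥0∞) ^ (1 / 2 : ℝ) ≠ ⊤ :=
    ENNReal.mul_ne_top ENNReal.coe_ne_top
      (ENNReal.rpow_ne_top_of_nonneg (by norm_num) ENNReal.coe_ne_top)
  refine ⟨((K : ℝ≥0∞) * (C : ℝ≥0∞) ^ (1 / 2 : ℝ)).toNNReal, fun s hs => ?_⟩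
  rw [ENNReal.coe_toNNReal hfin]
  calc eLpNorm (v s) 6 volume
      ≤ (K : ℝ≥0∞) * (∫⁻ y, ENNReal.ofReal (frobeniusNormSq (fderiv ℝ (v s) y))) ^ (1 / 2 : ℝ) :=
        hK (v s) (LpsOfSobolev.contDiff_slice hsm hs) (hL6 s hs)
    _ ≤ (K : ℝ≥0∞) * (C : ℝ≥0∞) ^ (1 / 2 : ℝ) :=
        mul_le_mul' le_rfl (ENNReal.rpow_le_rpow (hC s hs) (by norm_num))

/-- **The X2 class is Oseen-mild.** A bounded ancient mild solution (`ν = 1`, duality form),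
smooth on `(−∞,0) × ℝ³`, with bounded enstrophy and `L⁶` slices, solves the Oseen integral
equation `v(t) = e^{(t−s)Δ}v(s) − B¹ₛ(v,v)(t)` pointwise for all `s < t < 0` (landed stub
`stub_oseenMildOfL6` with the uniform `L⁶` bound `eLpNorm_six_le`): KNSS's parasitic drifts do
not survive the `L⁶` hypothesis. [cite: KochNadirashviliSereginSverak2009, Lemma 3.1 and §1 p. 3] -/
theorem oseenMild {v : ℝ → EuclideanSpace ℝ (Fin 3) → EuclideanSpace ℝ (Fin 3)}
    (hv : IsBoundedAncientMildSolution 1 v)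
    (hsm : ContDiffOn ℝ (⊤ : ℕ∞) (uncurry v) (Iio 0 ×ˢ univ))
    (hens : ∃ C : NNReal, ∀ s < 0, ∫⁻ y, ENNReal.ofReal (frobeniusNormSq (fderiv ℝ (v s) y)) ≤ C)
    (hL6 : ∀ s < 0, MemLp (v s) 6 volume) :
    ∀ s t : ℝ, s < t → t < 0 → ∀ x,
      v t x = UnboundedOperators.heatExtension (v s) (t - s) x - oseenDuhamel 1 s v v t x :=
  stub_oseenMildOfL6 v hv hsm.continuousOn (eLpNorm_six_le hsm hens hL6)

/-- The backward arithmetic progression `t₀ − k T` (`T > 0`) tends to `−∞`. [folklore] -/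
theorem tendsto_sub_mul_atBot (t₀ : ℝ) {T : ℝ} (hT : 0 < T) :
    Tendsto (fun k : ℕ => t₀ - (k : ℝ) * T) atTop atBot := by
  have h1 : Tendsto (fun k : ℕ => (k : ℝ) * T) atTop atTop :=
    tendsto_natCast_atTop_atTop.atTop_mul_const hT
  have h2 : Tendsto (fun k : ℕ => -((k : ℝ) * T)) atTop atBot := tendsto_neg_atTop_atBot.comp h1
  have h3 : Tendsto (fun k : ℕ => t₀ + -((k : ℝ) * T)) atTop atBot :=
    tendsto_atBot_add_const_left _ _ h2
  simpa only [sub_eq_add_neg] using h3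

/-- A backward-periodic field (`v (t − T) = v t` for `t < 0`) repeats its slice `v t₀` at the
times `t₀ − k T`. [folklore] -/
theorem slice_sub_mul_eq {v : ℝ → EuclideanSpace ℝ (Fin 3) → EuclideanSpace ℝ (Fin 3)} {T : ℝ}
    (hT : 0 < T) (hper : ∀ t < 0, v (t - T) = v t) {t₀ : ℝ} (ht₀ : t₀ < 0) (k : ℕ) :
    v (t₀ - (k : ℝ) * T) = v t₀ := by
  induction k with
  | zero => simp
  | succ k ih =>
    have hk : t₀ - (k : ℝ) * T < 0 := by
      have : 0 ≤ (k : ℝ) * T := by positivity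
      linarith
    have e : t₀ - ((k + 1 : ℕ) : ℝ) * T = (t₀ - (k : ℝ) * T) - T := by
      push_cast
      ring
    rw [e, hper _ hk, ih]

end L3Corner

/-- **X2 in its backward-`L³` corner, PROVED.** A bounded ancient mild solution of Navier–Stokes
(`ν = 1`, duality form), smooth on `(−∞,0) × ℝ³`, with uniformly bounded enstrophy and `L⁶`
slices, whose `L³` norms are bounded along ONE sequence of times `τ_k → −∞`, vanishes
identically: the class is Oseen-mild (`L3Corner.oseenMild`) and Albritton–Barker's Theorem 1.2
(`AlbrittonBarker2019_liouville_L3_backward_holds`, proved in the tree) applies. This is the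
second gate of the two-gate skeleton, closed. [cite: AlbrittonBarker2019, Thm 1.2] -/
theorem parabolicGaldiLiouville_L3Corner :
    ∀ v : ℝ → EuclideanSpace ℝ (Fin 3) → EuclideanSpace ℝ (Fin 3),
      Literature.Analysis.FluidPDE.IsBoundedAncientMildSolution 1 v →
      ContDiffOn ℝ (⊤ : ℕ∞) (Function.uncurry v) (Set.Iio 0 ×ˢ Set.univ) →
      (∃ C : NNReal, ∀ s < 0, ∫⁻ y, ENNReal.ofReal
          (Literature.Analysis.FluidPDE.frobeniusNormSq (fderiv ℝ (v s) y)) ≤ C) →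
      (∀ s < 0, MeasureTheory.MemLp (v s) 6 MeasureTheory.volume) →
      (∃ (τ : ℕ → ℝ) (M : ENNReal), M < ⊤ ∧ Filter.Tendsto τ Filter.atTop Filter.atBot ∧
        (∀ k, τ k < 0) ∧ ∀ k, MeasureTheory.eLpNorm (v (τ k)) 3 MeasureTheory.volume ≤ M) →
      ∀ s < 0, ∀ y, v s y = 0 := by
  intro v hv hsm hens hL6 hL3 s hs y
  exact AlbrittonBarker2019_liouville_L3_backward_holds hsm.continuousOn hv.2
    (fun t ht => hv.1.1 t ht) (L3Corner.oseenMild hv hsm hens hL6) hL3 s hs y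

/-- **X2 in its FINITE-ENERGY corner, PROVED.** A flow of the X2 class whose kinetic energy
`∫ ‖v(τ_k)‖²` is bounded along one sequence of times `τ_k → −∞` vanishes identically
(bounded + energy ⇒ `L³` along the sequence, the tree's
`PlaneEnergyCeilingPlanarEnergyLiouville.eLpNorm_three_le_of_energy`, and the backward-`L³`
corner). In particular every flow of the class with `sup_{s<0} ‖v(s)‖_{L²} < ∞`
(e.g. a finite-energy time-periodic flow) is trivial. [cite: AlbrittonBarker2019, Thm 1.2] -/
theorem parabolicGaldiLiouville_energyCorner :
    ∀ v : ℝ → EuclideanSpace ℝ (Fin 3) → EuclideanSpace ℝ (Fin 3),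
      Literature.Analysis.FluidPDE.IsBoundedAncientMildSolution 1 v →
      ContDiffOn ℝ (⊤ : ℕ∞) (Function.uncurry v) (Set.Iio 0 ×ˢ Set.univ) →
      (∃ C : NNReal, ∀ s < 0, ∫⁻ y, ENNReal.ofReal
          (Literature.Analysis.FluidPDE.frobeniusNormSq (fderiv ℝ (v s) y)) ≤ C) →
      (∀ s < 0, MeasureTheory.MemLp (v s) 6 MeasureTheory.volume) →
      (∃ (τ : ℕ → ℝ) (E : ENNReal), E < ⊤ ∧ Filter.Tendsto τ Filter.atTop Filter.atBot ∧
        (∀ k, τ k < 0) ∧ ∀ k, ∫⁻ x, ‖v (τ k) x‖ₑ ^ 2 ≤ E) →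
      ∀ s < 0, ∀ y, v s y = 0 := by
  intro v hv hsm hens hL6 hE
  obtain ⟨τ, E, hEt, hτ, hτ0, hEk⟩ := hE
  obtain ⟨K, hK⟩ := hv.2
  refine parabolicGaldiLiouville_L3Corner v hv hsm hens hL6
    ⟨τ, (ENNReal.ofReal K * E) ^ (1 / 3 : ℝ), ?_, hτ, hτ0, fun k => ?_⟩
  · exact ENNReal.rpow_lt_top_of_nonneg (by norm_num)
      (ENNReal.mul_ne_top ENNReal.ofReal_ne_top hEt.ne)
  · exact PlaneEnergyCeilingPlanarEnergyLiouville.eLpNorm_three_le_of_energy (hK _ (hτ0 k)) (hEk k)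

/-- **X2 for backward-PERIODIC flows with one `L³` slice, PROVED.** A flow of the X2 class which
is time-periodic backward (`v (t − T) = v t` for all `t < 0`, some period `T > 0`) and has a
single slice `v(t₀) ∈ L³(ℝ³)`, `t₀ < 0`, vanishes identically: the slice recurs along
`τ_k = t₀ − kT → −∞` and the backward-`L³` corner applies. (The route's layer-2 rung
"time-periodic finite-enstrophy flows", in its `L³` corner; steady flows are the case of every
period.) [cite: AlbrittonBarker2019, Thm 1.2] -/
theorem parabolicGaldiLiouville_periodic_L3 :
    ∀ v : ℝ → EuclideanSpace ℝ (Fin 3) → EuclideanSpace ℝ (Fin 3),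
      Literature.Analysis.FluidPDE.IsBoundedAncientMildSolution 1 v →
      ContDiffOn ℝ (⊤ : ℕ∞) (Function.uncurry v) (Set.Iio 0 ×ˢ Set.univ) →
      (∃ C : NNReal, ∀ s < 0, ∫⁻ y, ENNReal.ofReal
          (Literature.Analysis.FluidPDE.frobeniusNormSq (fderiv ℝ (v s) y)) ≤ C) →
      (∀ s < 0, MeasureTheory.MemLp (v s) 6 MeasureTheory.volume) →
      (∃ T : ℝ, 0 < T ∧ ∀ t < 0, v (t - T) = v t) →
      (∃ t₀ : ℝ, t₀ < 0 ∧ MeasureTheory.MemLp (v t₀) 3 MeasureTheory.volume) →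
      ∀ s < 0, ∀ y, v s y = 0 := by
  intro v hv hsm hens hL6 hper h3
  obtain ⟨T, hT, hper⟩ := hper
  obtain ⟨t₀, ht₀, h3⟩ := h3
  refine parabolicGaldiLiouville_L3Corner v hv hsm hens hL6
    ⟨fun k => t₀ - (k : ℝ) * T, eLpNorm (v t₀) 3 volume, h3.eLpNorm_lt_top,
      L3Corner.tendsto_sub_mul_atBot t₀ hT, fun k => ?_, fun k => ?_⟩
  · have : 0 ≤ (k : ℝ) * T := by positivity
    linarith
  · rw [L3Corner.slice_sub_mul_eq hT hper ht₀ k]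

/-- **TIGHTNESS of reshaping 3: the weakened open stub still contains Galdi's problem,
`stub_twoGate → GaldiLiouville`.** Given a D-solution `(U, P)` (viscosity `ν`), normalise to
`ν = 1` (`Tightness.normalise`) and view `W = ν⁻¹U` as the steady inhabitant `fun _ => W` of the
X2 class (`Tightness.steady_hypotheses`). Gate 1 (square-integrable enstrophy history of a
CONSTANT enstrophy over `volume (Iio 0) = ∞`) forces `∫|∇W|_F² = 0`, whence `W = 0`
(`Tightness.eq_zero_of_lintegral_frobeniusNormSq_eq_zero`); gate 2 (bounded `L³` norms along a
backward sequence) is the backward-`L³` corner `parabolicGaldiLiouville_L3Corner`, whence again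
`W = 0`. The hypothesis is verbatim the registered stub `stub_twoGate` of crux
stmt-NavierStokesRegularity-0893. -/
theorem galdiLiouville_of_twoGate
    (hstub : ∀ v : ℝ → EuclideanSpace ℝ (Fin 3) → EuclideanSpace ℝ (Fin 3),
      Literature.Analysis.FluidPDE.IsBoundedAncientMildSolution 1 v →
      ContDiffOn ℝ (⊤ : ℕ∞) (Function.uncurry v) (Set.Iio 0 ×ˢ Set.univ) →
      (∃ C : NNReal, ∀ s < 0, ∫⁻ y, ENNReal.ofReal
          (Literature.Analysis.FluidPDE.frobeniusNormSq (fderiv ℝ (v s) y)) ≤ C) →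
      (∀ s < 0, MeasureTheory.MemLp (v s) 6 MeasureTheory.volume) →
      (∫⁻ s in Set.Iio 0, (∫⁻ y, ENNReal.ofReal
          (Literature.Analysis.FluidPDE.frobeniusNormSq (fderiv ℝ (v s) y))) ^ 2) < ⊤ ∨
      (∃ (τ : ℕ → ℝ) (M : ENNReal), M < ⊤ ∧ Filter.Tendsto τ Filter.atTop Filter.atBot ∧
        (∀ k, τ k < 0) ∧ ∀ k, MeasureTheory.eLpNorm (v (τ k)) 3 MeasureTheory.volume ≤ M)) :
    Theses.GaldiLiouvilleGate.GaldiLiouville := by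
  intro ν hν U P hprof hU hP hD h0
  obtain ⟨hst, hW, hQ, hDW, h0W⟩ := Tightness.normalise hν hprof hU hP hD h0
  obtain ⟨h1, h2, h3, h4⟩ := Tightness.steady_hypotheses hst hW hQ hDW h0W
  set W : EuclideanSpace ℝ (Fin 3) → EuclideanSpace ℝ (Fin 3) := ν⁻¹ • U with hWdef
  have hW1 : ContDiff ℝ 1 W := hW.of_le (by exact_mod_cast le_top)
  suffices hzero : ∀ y, W y = 0 from
    Tightness.eq_zero_of_inv_smul_eq_zero hν (fun y => by rw [← hWdef]; exact hzero y)
  rcases hstub (fun _ => W) h1 h2 h3 h4 with hfin | hL3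
  · -- gate 1: the constant enstrophy history is square-integrable only if it vanishes
    set D : ℝ≥0∞ := ∫⁻ y, ENNReal.ofReal (frobeniusNormSq (fderiv ℝ W y)) with hDdef
    have hfin' : D ^ 2 * volume (Iio (0 : ℝ)) < ⊤ := by
      rw [← setLIntegral_const]
      exact hfin
    rw [Real.volume_Iio] at hfin'
    have hD2 : D ^ 2 = 0 := by
      by_contra hne
      rw [ENNReal.mul_top hne] at hfin'
      exact lt_irrefl _ hfin'
    have hD0 : D = 0 := pow_eq_zero_iff (n := 2) two_ne_zero |>.1 hD2
    exact Tightness.eq_zero_of_lintegral_frobeniusNormSq_eq_zero hW1 h0W hD0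
  · -- gate 2: the backward-`L³` corner, at the time `-1`
    intro y
    exact parabolicGaldiLiouville_L3Corner (fun _ => W) h1 h2 h3 h4 hL3 (-1) (by norm_num) y

end Summit.NavierStokesRegularity.NavierStokesRegularity.Theorems.ParabolicGaldiLiouville.Birth

end
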